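import Mathlib.Algebra.Polynomial.Roots
import Summits.KontsevichZagierPeriods.Zeta5Search.Certificates.ModRedNKSum
import Summits.KontsevichZagierPeriods.Zeta5Search.Certificates.VIMLevel2K2Nat
import HarnessLib

/-!
# ζ(5) search — brown9 LEVEL 2 (R-NK) by kernel module reduction: all rational `k₃`, and the integer form (cell `pub-zeta5`, certifier `cert-2`)

HONEST FRAMING: systematic search; no irrationality claim unless certified.

`Certificates/ModRedNKSum.lean` proved the lane's `n`-shift relation (R-NK)
`η₁₀(n,x)·R(n+1,x) + η₀₀(n,x)·R(n,x) + η₀₁(n,x)·R(n,x+1) = 0` (`η` = the data `etaNK··` ×5, `R = VIMInner.Rsum`) for `n ≥ 3`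
and every NON-INTEGRAL rational `x` (the module reduction divides by linear forms `… ± x` that vanish only at integers).
Here the gap is closed by POLYNOMIALITY, exactly as cert-1 did for (R-K2) (`VIMLevel2K2All`): for fixed `n` the left-hand side
is a polynomial function of `x` (`PolyRep`; `ev2` of data is polynomial in its second argument, `polyRep_ev2`), it vanishes
on the infinite set of non-integers (`{k + 1/2}`), hence everywhere:
* `R_rel_NK_all (n ≥ 3) (x : ℚ)` — (R-NK) for EVERY rational `x`;
* `R_rel_NK_nat` — with cert-1's integer sums `RsumNat` (genuine `ℕ` subtractions) for `k₃ + 1 ≤ n`;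
* `etaNK10_eq` — the leading coefficient in closed form, `5η₁₀ = (n+1)³(x−2n−2)²(x−2n−1)²` (never zero for `x ≤ 2n`).
An independent cross-replay, by a different route (no reduction multipliers), of cert-1 g2's `VIMInner.NK.R_rel_NK`.
-/

noncomputable section

namespace Summit.KontsevichZagierPeriods.Zeta5Search.Certificates

namespace VIMInner.ModRed

open Finset Polynomial
open Summit.KontsevichZagierPeriods.Zeta5Search.PolyReflect

/-! ### Polynomiality in `x` -/

/-- `x ↦ ev2 p w x` is polynomial in `x` (any `Poly2` data `p`, fixed `w`). -/
def polyRep_ev2 (w : ℚ) : ∀ p : Poly2, PolyRep fun x => ev2 p w x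
  | [] => ⟨0, fun x => by simp⟩
  | a :: p =>
    let h := polyRep_ev2 w p
    ⟨Polynomial.C (ev1 a w) + X * h.poly, fun x => by simp [h.eval_eq x]⟩

/-- The (R-NK) combination as a polynomially represented function of `x`. -/
def polyRep_NK (n : ℕ) :
    PolyRep fun x => ev2 etaNK10 n x * Rsum (n + 1) x + ev2 etaNK00 n x * Rsum n x + ev2 etaNK01 n x * Rsum n (x + 1) := by
  have h1 : PolyRep fun x => Rsum (n + 1) x := by
    have h := polyRep_Rsum (n + 1) 0
    exact ⟨h.poly, fun x => by rw [← add_zero x, h.eval_eq x, add_zero]⟩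
  have h0 : PolyRep fun x => Rsum n x := by
    have h := polyRep_Rsum n 0
    exact ⟨h.poly, fun x => by rw [← add_zero x, h.eval_eq x, add_zero]⟩
  exact (((polyRep_ev2 n etaNK10).mul h1).add ((polyRep_ev2 n etaNK00).mul h0)).add
    ((polyRep_ev2 n etaNK01).mul (polyRep_Rsum n 1))

/-- The non-integral rationals form an infinite set (`k + 1/2`, `k : ℕ`). -/
theorem infinite_not_int : Set.Infinite {x : ℚ | ∀ z : ℤ, x ≠ z} := by
  refine Set.infinite_of_injective_forall_mem (f := fun k : ℕ => (k : ℚ) + 1 / 2) ?_ ?_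
  · intro a b h
    have : (a : ℚ) = b := by simpa using h
    exact_mod_cast this
  · intro k z hz
    have h2 : (2 * k + 1 : ℤ) = 2 * z := by
      have : (2 * (k : ℚ) + 1) = 2 * (z : ℚ) := by linarith
      exact_mod_cast this
    omega

/-- A polynomially represented function vanishing at every non-integral rational vanishes everywhere. -/
theorem PolyRep.eq_zero_of_not_int {f : ℚ → ℚ} (hf : PolyRep f) (h : ∀ x : ℚ, (∀ z : ℤ, x ≠ z) → f x = 0) (x : ℚ) :
    f x = 0 := by
  have hroots : Set.Infinite {y : ℚ | IsRoot hf.poly y} := by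
    refine infinite_not_int.mono ?_
    intro y hy
    simp only [Set.mem_setOf_eq, IsRoot.def, ← hf.eval_eq y]
    exact h y hy
  have hP0 : hf.poly = 0 := Polynomial.eq_zero_of_infinite_isRoot _ hroots
  rw [hf.eval_eq x, hP0, eval_zero]

/-! ### (R-NK) for every rational `k₃`, and the integer form -/

/-- **(R-NK), all `x`**: for `n ≥ 3` and EVERY rational `x` (in particular every integer `k₃`),
`η₁₀(n,x)·R(n+1,x) + η₀₀(n,x)·R(n,x) + η₀₁(n,x)·R(n,x+1) = 0` — the ttrl2 lane's `n`-shift relation of the inner double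
sum of fam-brown9's leading coefficient, with `η = ev2 etaNK··` (×5) and `R = Rsum`. -/
theorem R_rel_NK_all (n : ℕ) (hn : 3 ≤ n) (x : ℚ) :
    ev2 etaNK10 n x * Rsum (n + 1) x + ev2 etaNK00 n x * Rsum n x + ev2 etaNK01 n x * Rsum n (x + 1) = 0 :=
  PolyRep.eq_zero_of_not_int (polyRep_NK n) (fun y hy => R_rel_NK n hn y hy) x

/-- **(R-NK) for the integer sums**: for `n ≥ 3` and `k₃ + 1 ≤ n` (so that all three double sums are genuine integer
binomial sums, cert-1's `RsumNat`): `η₁₀ R_ℕ(n+1,k₃) + η₀₀ R_ℕ(n,k₃) + η₀₁ R_ℕ(n,k₃+1) = 0`. -/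
theorem R_rel_NK_nat (n k₃ : ℕ) (hn : 3 ≤ n) (hk : k₃ + 1 ≤ n) :
    ev2 etaNK10 n k₃ * RsumNat (n + 1) k₃ + ev2 etaNK00 n k₃ * RsumNat n k₃
      + ev2 etaNK01 n k₃ * RsumNat n (k₃ + 1) = 0 := by
  have h := R_rel_NK_all n hn k₃
  rw [show (k₃ : ℚ) + 1 = ((k₃ + 1 : ℕ) : ℚ) by push_cast; ring, Rsum_natCast (n + 1) k₃ (by omega),
    Rsum_natCast n k₃ (by omega), Rsum_natCast n (k₃ + 1) hk] at h
  exact h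

/-- The leading coefficient of (R-NK) in closed form: `ev2 etaNK10 n x = (n+1)³(x−2n−2)²(x−2n−1)²` (`= 5η₁₀` of the lane;
non-zero unless `x ∈ {2n+1, 2n+2}`, so (R-NK) determines `R(n+1,·)` from `R(n,·)` on `x ≤ 2n`). -/
theorem etaNK10_eq (w x : ℚ) : ev2 etaNK10 w x = (w + 1) ^ 3 * (x - 2 * w - 2) ^ 2 * (x - 2 * w - 1) ^ 2 := by
  simp [etaNK10, ev2, ev1]; ring

end VIMInner.ModRed

end Summit.KontsevichZagierPeriods.Zeta5Search.Certificates
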